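import Mathlib
import Summits.ValiantsHypothesis.ValiantsHypothesis.Theorems.FifoMatchingNNLinearDegreeCofactorHardShedWordGatePricing
import Summits.ValiantsHypothesis.ValiantsHypothesis.Theorems.FifoMatchingNNLinearDegreeCofactorHardShedWordEnds
import Summits.ValiantsHypothesis.ValiantsHypothesis.Theorems.FifoMatchingNNLinearDegreeCofactorHardShedWordParams
import HarnessLib

/-!
# Crux `NNLinearDegreeCofactorHard` (stmt-ValiantsHypothesis-23918), line `internal_cofactor`, stub S2b (ii):
# μ* = shedWord — THE MEASURE for one window (assembly of band, balance, heart, gates, pricing, parameters)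

For a window of even length `N` with defect set `R′` (`1012·#R′ ≤ N + 4`, end densities `≤ 1/4`):

* `pricing_large` — if `g = root16 N ≥ 4096`: with `H = g¹²`, `w = g¹¹`, `E = N − 2(#R′ + H + w)`, the band bit strings
  `BB = {y : |fairWalk| < w on [H, E]}` are at least half of all, `y ↦ fifo (shedWord R′ H E y)` maps them into the R′-avoiding
  nest-free perfect matchings, and for every balanced `S` the respecting ones satisfy `# · (4/3)^{g/32} ≤ 2^N`
  (`heart_popped` + `rate_of_heart` + `card_resp_mul_le_of_gates`);
* `pricing_small` — for every `N`: the one-point measure `fifo (shedWord R′ 0 0 _)` with rate `0`.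

Honest framing: this is the measure-side content of S2b for μ*; the crux assembly is the sequel file.  Nothing here proves
VP ≠ VNP (not proved).  No new definitions. [folklore]
-/

noncomputable section

-- Sub = Summit single-conjunct layout: the duplicated namespace component is mandated by the tree.
set_option linter.dupNamespace false

namespace Summit.ValiantsHypothesis.ValiantsHypothesis.Theorems.FifoMatching.NNLinearDegreeCofactorHard.ShedWord

open Finset Literature.Computability.AlgebraicComplexity
open Summit.ValiantsHypothesis.ValiantsHypothesis.Theorems.FifoMatching.NNMonotoneHard
open Summit.ValiantsHypothesis.ValiantsHypothesis.Theorems.FifoMatching.NNLinearDegreeCofactorHard.QueueHistory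
open Summit.ValiantsHypothesis.ValiantsHypothesis.Theorems.FifoMatching.NNLinearDegreeCofactorHard.CondProbBits

variable {N : ℕ} (R : Finset (Fin N))

/-- **The pricing of μ* above the threshold.** [folklore] -/
theorem pricing_large (hN : Even N) (hg : 4096 ≤ root16 N) (hRc : 1012 * R.card ≤ N + 4)
    (hpre : ∀ t ≤ N, 4 * (R.filter fun j => j.val < t).card ≤ t)
    (hsuf : ∀ t ≤ N, 4 * (R.filter fun j => N ≤ j.val + t).card ≤ t) :
    ∃ BB : Finset (Fin N → Bool), ∃ f : (Fin N → Bool) → (Fin N → Fin N),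
      BB.Nonempty ∧ (∀ y ∈ BB, f y ∈ (nestFreeMatchings N).filter (fun M => ∀ j ∈ R, M j ∉ R)) ∧
      (2 : ℝ) ^ N ≤ 2 * BB.card ∧
      ∀ S : Finset (Fin N), N < 3 * S.card → 3 * S.card ≤ 2 * N →
        ((BB.filter fun y => ∀ i, i ∈ S ↔ f y i ∈ S).card : ℝ) * (4 / 3 : ℝ) ^ (root16 N / 32) ≤ 2 ^ N := by
  classical
  -- parameters
  have hfit := fit hg hRc
  have hfill := fill_gt_band (g := root16 N) (by omega)
  have hHN : root16 N ^ 12 ≤ N := by omega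
  have hF₀l := freeCount_fill_ge R (root16 N ^ 12) hHN hpre
  have hF₀u := freeCount_fill_le R (root16 N ^ 12)
  have hwF : root16 N ^ 11 < freeCount R 0 (root16 N ^ 12) := by omega
  have h2le : 2 * (R.card + root16 N ^ 12 + root16 N ^ 11) ≤ N := by omega
  have hHE : root16 N ^ 12 ≤ N - 2 * (R.card + root16 N ^ 12 + root16 N ^ 11) := by omega
  have hEN : N - 2 * (R.card + root16 N ^ 12 + root16 N ^ 11) ≤ N := Nat.sub_le _ _
  have hNE : N - (N - 2 * (R.card + root16 N ^ 12 + root16 N ^ 11)) = 2 * (R.card + root16 N ^ 12 + root16 N ^ 11) :=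
    Nat.sub_sub_self h2le
  have hNpos : 0 < N := lt_of_lt_of_le (by positivity : 0 < (4096 : ℕ) ^ 16)
    ((Nat.pow_le_pow_left hg 16).trans (root16_pow_le N))
  have hgood := hgood_of_suffix R (N - 2 * (R.card + root16 N ^ 12 + root16 N ^ 11)) hsuf
  have hpar := hpar_of_suffix R (root16 N ^ 12) hsuf (w := root16 N ^ 11) h2le
  -- abbreviations
  set H := root16 N ^ 12 with hH
  set w := root16 N ^ 11 with hw
  set E := N - 2 * (R.card + H + w) with hE
  set BB := (univ : Finset (Fin N → Bool)).filter fun y => ∀ s, H ≤ s → s ≤ E → |fairWalk R H E y s| < w with hBB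
  have hbandB : ∀ y ∈ BB, ∀ s, H ≤ s → s ≤ E → |fairWalk R H E y s| < w := fun y hy => (mem_filter.1 hy).2
  have hbalB : ∀ y ∈ BB, (closerSet (shedWord R H E y)).card = (openerSet (shedWord R H E y)).card := fun y hy =>
    balanced_of_band R H E y hN hHE hEN hgood hwF.le (hbandB y hy) hpar
  set f : (Fin N → Bool) → (Fin N → Fin N) := fun y =>
    if h : (closerSet (shedWord R H E y)).card = (openerSet (shedWord R H E y)).card then fifo (shedWord R H E y) h
    else fun i => i with hf
  have hfB : ∀ y (hy : y ∈ BB), f y = fifo (shedWord R H E y) (hbalB y hy) := fun y hy => by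
    simp only [hf]; rw [dif_pos (hbalB y hy)]
  -- the band count
  have hcount : (2 : ℝ) ^ N ≤ 2 * BB.card := card_band_ge R H E hNpos hEN (band_poly hg)
  refine ⟨BB, f, ?_, fun y hy => ?_, hcount, fun S hS₁ hS₂ => ?_⟩
  · rw [← card_pos]
    have : (0 : ℝ) < BB.card := by
      have : (0 : ℝ) < 2 ^ N := by positivity
      linarith
    exact_mod_cast this
  · rw [hfB y hy]; exact fifo_shedWord_mem R H E y (hbalB y hy)
  · set A := BB.filter fun y => ∀ i, i ∈ S ↔ f y i ∈ S with hA
    have hAB : ∀ y ∈ A, y ∈ BB := fun y hy => (mem_filter.1 hy).1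
    have hrespA : ∀ y (hy : y ∈ A), ∀ i, i ∈ S ↔ fifo (shedWord R H E y) (hbalB y (hAB y hy)) i ∈ S := by
      intro y hy
      have h := (mem_filter.1 hy).2
      rwa [hfB y (hAB y hy)] at h
    refine card_resp_mul_le_of_gates R H E S hEN hwF A (root16 N / 32) (fun y hy => hbandB y (hAB y hy))
      (fun y hy => hbalB y (hAB y hy)) hrespA fun y hy => ?_
    -- the heart and the rate
    have hheart := heart_popped R H E y (hbalB y (hAB y hy)) hHE hEN hwF.le (hbandB y (hAB y hy)) S hS₁ hS₂ (hrespA y hy)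
    have htests := testsAll_le_card_isTest R H E y S hEN hwF.le (hbandB y (hAB y hy))
    rw [hNE] at hheart
    refine rate_of_heart (T := ((range N).filter fun j => isTest R H E y S j = true).card) hg hRc hF₀l hF₀u ?_
    simp only [hH, hw] at hheart htests ⊢
    rcases hheart with h | h
    · exact Or.inl h
    · exact Or.inr (by omega)

/-- **The one-point measure below the threshold** (rate `0`). [folklore] -/
theorem pricing_small (hN : Even N) (hsuf : ∀ t ≤ N, 4 * (R.filter fun j => N ≤ j.val + t).card ≤ t) :
    ∃ BB : Finset (Fin N → Bool), ∃ f : (Fin N → Bool) → (Fin N → Fin N),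
      BB.Nonempty ∧ (∀ y ∈ BB, f y ∈ (nestFreeMatchings N).filter (fun M => ∀ j ∈ R, M j ∉ R)) ∧
      (2 : ℝ) ^ N ≤ 2 * BB.card ∧
      ∀ S : Finset (Fin N), N < 3 * S.card → 3 * S.card ≤ 2 * N →
        ((BB.filter fun y => ∀ i, i ∈ S ↔ f y i ∈ S).card : ℝ) * (4 / 3 : ℝ) ^ (0 : ℕ) ≤ 2 ^ N := by
  classical
  have hbal := balanced_drain R (fun _ => false) hN hsuf
  refine ⟨univ, fun _ => fifo (shedWord R 0 0 fun _ => false) hbal, univ_nonempty, fun y _ =>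
    fifo_shedWord_mem R 0 0 _ hbal, ?_, fun S _ _ => ?_⟩
  · rw [card_univ, Fintype.card_fun, Fintype.card_bool, Fintype.card_fin]; push_cast; linarith [pow_pos (by norm_num : (0:ℝ) < 2) N]
  · rw [pow_zero, mul_one]
    have h := card_filter_le (univ : Finset (Fin N → Bool))
      (fun y => ∀ i, i ∈ S ↔ fifo (shedWord R 0 0 fun _ => false) hbal i ∈ S)
    rw [card_univ, Fintype.card_fun, Fintype.card_bool, Fintype.card_fin] at h
    exact_mod_cast h

end Summit.ValiantsHypothesis.ValiantsHypothesis.Theorems.FifoMatching.NNLinearDegreeCofactorHard.ShedWord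

end
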